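import Literature.NumberTheory.PAdicHodge.BmaxPlusBdRModFilLogType
import Literature.NumberTheory.PAdicHodge.BdRPlusFormalLogModFil
import Literature.NumberTheory.PAdicHodge.BdRPlusLogTeich
import HarnessLib

/-!
# The comparison `B_max⁺ → B_dR⁺/Fil^k` on the φ-road periods: formal-group logarithms `log_W` and Teichmüller logarithms `log[x]`

Topic `Literature/NumberTheory/PAdicHodge`; namespace `Literature.NumberTheory.PAdicHodge`. THEOREMS ONLY (no definition, no named
fact, no instance, no `sorry`). Corollaries of `BmaxPlusBdRModFilLogType` (`Λᵇ_N(y₀) ↦ p^N·ℓ_b(y₀)`) for the two numerator sequences the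
φ-road of line `kato_lever` uses (crux K★ `stmt-BirchSwinnertonDyer-22226`, memo `…/kato-lever-K2-phi-road.md` §1, bricks B5/B8):

* ★ `exists_isFormalLogModFil_of_bdR_lim_modFil_logSum` — with `b = formalLogNum W p` (an integral Weierstrass equation `W/ℤ`): a limit `L`
  modulo `Fil^k` of the `A_max`-period `Λ^W_N(x₀, z) = p^N·log_W(x₀)` satisfies `L = p^N·L'` with **`IsFormalLogModFil W k x₀ L'`** — the
  `A_max`-periods of the φ-road ARE the `B_dR⁺`-periods of the LEAD's chain (`BdRPlusFormalLogModFil`, floor (H4));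
* `isLogTypeModFil_congr` — `IsLogTypeModFil b` only depends on `b m`, `m ≥ 1`;
* ★ `exists_isTeichLog_of_bdR_lim_modFil_logSum` — with the logarithm numerators `(−1)^{m+1}` at `y₀ = [x] − 1`, `x₀ = 1`
  (the sum `Λ^{log}_N([x] − 1)` of `BmaxPlusLogSeriesFrobenius.frobBmaxPlus_logSum_teichmuller_sub_one`, `φΛ = pΛ`): a limit `L` satisfies
  `L = p^N·L'` with **`IsTeichLog k L'`** — the `A_max`-elements `p^N·log[x]` map into the `ℤ_p(1)`-structure `X⁰_k = log[1+𝔪♭] mod Fil^k`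
  of the socket (`BdRPlusLogTeich`).

Infrastructure only: BSD / K★ are not proved by any of this.

## References
* [Colmez1992PeriodesAbeliennes] P. Colmez, *Périodes p-adiques des variétés abéliennes*, Math. Ann. 292 (1992), §2.
* [FontaineAsterisque223III] J.-M. Fontaine, *Le corps des périodes p-adiques*, Astérisque 223 (1994), Exp. II §1.5.4.
* [Fontaine1982FormesDifferentielles] J.-M. Fontaine, Invent. Math. 65 (1982), §5.
-/

noncomputable section

open WittVector Field ValuativeRel Finset
open Literature.AlgebraicGeometry.Resolution
open Literature.RingTheory.FormalGroups

namespace Literature.NumberTheory.PAdicHodge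

open Literature.NumberTheory.GaloisRepresentations
open Literature.NumberTheory.GaloisRepresentations.IsNonarchimedeanLocalField
open GaloisContinuity

variable {F : Type} [Field F] [ValuativeRel F] [TopologicalSpace F] [IsNonarchimedeanLocalField F]
  [CharZero F] {p : ℕ} [Fact p.Prime] [Fact (¬ IsUnit (p : integerC F))]
  [IsAdicComplete (Ideal.span {(p : integerC F)}) (integerC F)]

/-! ### §1 Formal-group logarithms -/

omit [CharZero F] in
/-- ★ **The `A_max`-period `Λ^W_N(x₀, z) = p^N·log_W(x₀)` maps to `p^N` times the `B_dR⁺/Fil^k`-period `log_W(ι x₀) mod Fil^k`.** For an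
integral Weierstrass equation `W/ℤ`, `x₀ ∈ 𝔸_inf` with `x₀^N = p·z` in `B⁰_max`, and a limit `L` of
`PadicLogSeries.logSum ι (formalLogNum W p) N x₀ z` modulo `Fil^k`: `L = p^N · L'` with `IsFormalLogModFil W k x₀ L'`.
[cite: Fontaine1982FormesDifferentielles, §5] [cite: Colmez1992PeriodesAbeliennes, §2] -/
theorem exists_isFormalLogModFil_of_bdR_lim_modFil_logSum (W : WeierstrassCurve ℤ) {N : ℕ} (hN : 1 ≤ N) (x₀ : Ainf (p := p) F)
    {z : bmaxZero F p} (hz : algebraMap (Ainf (p := p) F) (bmaxZero F p) x₀ ^ N = (p : bmaxZero F p) * z)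
    {k : ℕ} {L : BDeRhamPlus (integerC F) p} {r : ℕ}
    (h : ∀ N' M : ℕ, N' + r ≤ M → ∀ y : bmaxZero F p,
      AdicCompletion.evalₐ (Ideal.span {(p : bmaxZero F p)}) M
          (PadicLogSeries.logSum ((algebraMap (Ainf (p := p) F) (bmaxZero F p)).comp zpToAinf) (formalLogNum W p) N
            (algebraMap (Ainf (p := p) F) (bmaxZero F p) x₀) z) = Ideal.Quotient.mk _ y →
      ∃ (a : Ainf (p := p) F) (w : BDeRhamPlus (integerC F) p),
        (p : BDeRhamPlus (integerC F) p) ^ k *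
            (L - algebraMap (Localization.Away (p : Ainf (p := p) F)) (BDeRhamPlus (integerC F) p)
              (y : Localization.Away (p : Ainf (p := p) F))) =
          ainfToBdR ((p : Ainf (p := p) F) ^ N' * a) + xiBdR ^ k * w) :
    ∃ L' : BDeRhamPlus (integerC F) p, (p : BDeRhamPlus (integerC F) p) ^ N * L' = L ∧ IsFormalLogModFil W k x₀ L' :=
  exists_isLogTypeModFil_of_bdR_lim_modFil_logSum (formalLogNum W p) hN x₀ hz h

/-- Hence **`log_W(ι x₀) mod Fil^k` exists for every `p`-nilpotent `x₀`** (e.g. lifts of deep division points; `BdRPlusFormalLogModFil` needs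
`x₀ ∈ (p, ξ)`). [cite: Fontaine1982FormesDifferentielles, §5] [cite: Colmez1992PeriodesAbeliennes, §2] -/
theorem exists_isFormalLogModFil_of_pow_eq (W : WeierstrassCurve ℤ) {N : ℕ} (hN : 1 ≤ N) (x₀ : Ainf (p := p) F)
    {z : bmaxZero F p} (hz : algebraMap (Ainf (p := p) F) (bmaxZero F p) x₀ ^ N = (p : bmaxZero F p) * z) (k : ℕ) :
    ∃ L' : BDeRhamPlus (integerC F) p, IsFormalLogModFil W k x₀ L' :=
  exists_isLogTypeModFil_of_pow_eq (formalLogNum W p) hN x₀ hz k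

/-! ### §2 Teichmüller logarithms `log[x]` -/

omit [CharZero F] in
/-- `IsLogTypeModFil b k y L` only depends on the numerators `b m` for `m ≥ 1`. [cite: FontaineAsterisque223III, Exp. II §1.5.4] -/
theorem isLogTypeModFil_congr {b b' : ℕ → ℤ_[p]} (hbb' : ∀ m, m ≠ 0 → b m = b' m) {k : ℕ} {y : Ainf (p := p) F}
    {L : BDeRhamPlus (integerC F) p} (hL : IsLogTypeModFil b k y L) : IsLogTypeModFil b' k y L := by
  have hP : ∀ M, logTypePartialSum b' y M = logTypePartialSum b y M := fun M => by
    simp only [logTypePartialSum, logTypeTerm, hbb' _ (Nat.succ_ne_zero _)]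
  intro j
  obtain ⟨M₀, hM₀⟩ := hL j
  exact ⟨M₀, fun M hM => by rw [hP M]; exact hM₀ M hM⟩

omit [CharZero F] in
/-- ★ **The `A_max`-elements `Λ^{log}_N([x] − 1, z) = p^N·log[x]` (`x₀ = 1`) map into the `ℤ_p(1)`-structure `X⁰_k` of the socket**: a limit
`L` modulo `Fil^k` of `PadicLogSeries.logSum ι ((−1)^{m+1})_m N ([x] − 1) z` satisfies `L = p^N·L'` with `IsTeichLog k L'`
(`IsTeichLog k L' ↔ ∃ x, x₀ = 1 ∧ IsLogModFil k ([x] − 1) L'`). [cite: FontaineAsterisque223III, Exp. II §1.5.4] [cite: Colmez1992PeriodesAbeliennes, §2] -/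
theorem exists_isTeichLog_of_bdR_lim_modFil_logSum (x : PreTilt (integerC F) p) (hx : PreTilt.coeff 0 x = 1) {N : ℕ} (hN : 1 ≤ N)
    {z : bmaxZero F p}
    (hz : algebraMap (Ainf (p := p) F) (bmaxZero F p) ((teichmuller p x : Ainf (p := p) F) - 1) ^ N = (p : bmaxZero F p) * z)
    {k : ℕ} {L : BDeRhamPlus (integerC F) p} {r : ℕ}
    (h : ∀ N' M : ℕ, N' + r ≤ M → ∀ y : bmaxZero F p,
      AdicCompletion.evalₐ (Ideal.span {(p : bmaxZero F p)}) M
          (PadicLogSeries.logSum ((algebraMap (Ainf (p := p) F) (bmaxZero F p)).comp zpToAinf)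
            (fun m => if m = 0 then 0 else (-1) ^ (m + 1)) N
            (algebraMap (Ainf (p := p) F) (bmaxZero F p) ((teichmuller p x : Ainf (p := p) F) - 1)) z) = Ideal.Quotient.mk _ y →
      ∃ (a : Ainf (p := p) F) (w : BDeRhamPlus (integerC F) p),
        (p : BDeRhamPlus (integerC F) p) ^ k *
            (L - algebraMap (Localization.Away (p : Ainf (p := p) F)) (BDeRhamPlus (integerC F) p)
              (y : Localization.Away (p : Ainf (p := p) F))) =
          ainfToBdR ((p : Ainf (p := p) F) ^ N' * a) + xiBdR ^ k * w) :
    ∃ L' : BDeRhamPlus (integerC F) p, (p : BDeRhamPlus (integerC F) p) ^ N * L' = L ∧ IsTeichLog k L' := by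
  obtain ⟨L', hL, hL'⟩ := exists_isLogTypeModFil_of_bdR_lim_modFil_logSum (fun m => if m = 0 then 0 else (-1) ^ (m + 1)) hN _ hz h
  refine ⟨L', hL, x, hx, ?_⟩
  rw [← isLogTypeModFil_neg_one_pow_iff]
  exact isLogTypeModFil_congr (fun m hm => by rw [if_neg hm]) hL'

end Literature.NumberTheory.PAdicHodge

end
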